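import Literature.Barriers.CriticalPhenomena.LaceExpansionXSpaceTwoLongLinesStages
import HarnessLib

/-!
# The leaves of Hara's two-long-lines estimate (§3.5) at `p_c`: every pair of positions of the two
# erased lines, as an explicit chain, is at most `𝕂¹⁸ κ^{n-4}` — PROVED

Barrier catalogue `Literature/Barriers/CriticalPhenomena/` (D-0021), infrastructure for the
conditional reduction of `Hara2008_twoLongLinesDiagramBoundPc` (`LaceExpansionXSpaceLemma15Diagrams.lean`,
Hara 2008, §3.5), continuing `LaceExpansionXSpaceTwoLongLinesStages.lean`.

The fine list `B₁, B₂, …, B₁` of the diagram of `Π^{(n+1)}` with the kernels at two positions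
replaced by erased kernels (`altL_set_ee/eo/oe/oo`), or with the start / end triangle erased, is
written out for every combination of kinds — `B₁` with a line erased, `B₂⁽¹⁾` with a crossed line
erased (its rungs moved to the neighbouring `B₁`: `surg_*`), the erased star block merged with its
two neighbours (`starK`) — and bounded by the matching configuration of
`LaceExpansionXSpaceTwoLongLinesConfigs.lean`: Cauchy–Schwarz when at least one full unit separates
the erasures, otherwise the adjacent, lone-star or overlapping bounds. Each leaf is
`≤ 𝕂¹⁸ κ^{e}` with `e ≥ n - 4` ("at least `(N-3)` factors of `cλ`"; our count loses one more unit at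
the merged star blocks). The coordinate relations between the two erased strands enter only where
needed (`hrel`): adjacent erasures sit on different coordinates, a lone star block on equal ones,
and two star blocks two units apart would erase two lines of the same strand, so they never occur
together.

## References

* T. Hara, Ann. Probab. 36 (2008) 530–593 (arXiv:math-ph/0504021): §3.5 (Cases 1–2, "(2N+1)²
  choices", "at least (N-3) factors of cλ").
* M. Heydenreich, R. van der Hofstad, *Progress in High-Dimensional Percolation and Random
  Graphs*, Springer 2017: (7.4.10), §7.5.2.
-/

noncomputable section

open scoped ENNReal

namespace Literature.Barriers.CriticalPhenomena

open _root_.MeasureTheory Literature.Probability.LatticeModels Literature.Probability.Percolation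

variable {d : ℕ}

/-! ### Small constants and list surgery -/

/-- `1 ≤ 𝕂²`. [folklore] -/
theorem one_le_bigK_sq (hd : 1 ≤ d) : (1 : ℝ≥0∞) ≤ bigK d ^ 2 := (one_le_bigK hd).trans (self_le_bigK_pow hd (by norm_num))

/-- `Δ̃Δ̄ ≤ 𝕂²`. [folklore] -/
theorem triTilde_tri_le_bigK_sq (hd : 1 ≤ d) : percTriTildeBar d * percTriBar d ≤ bigK d ^ 2 := by
  rw [sq]; exact mul_le_mul' percTriTildeBar_le_bigK (percTriBar_le_bigK hd)

/-- `1 · ρ ≤ ρ`. [folklore] -/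
theorem one_mul_rho_le (P : Site d × Site d) : (fun _ : Site d × Site d => (1 : ℝ≥0∞)) P * rho d P ≤ rho d P :=
  le_of_eq (one_mul _)

/-- `ρ · 1 ≤ ρ`. [folklore] -/
theorem rho_mul_one_le (P : Site d × Site d) : rho d P * (fun _ : Site d × Site d => (1 : ℝ≥0∞)) P ≤ rho d P :=
  le_of_eq (mul_one _)

/-- `τ(·)`'s `T`-form bounds restated for `τ = lineF true`. [folklore] -/
theorem tForm_lineF_tau_le (hd : 1 ≤ d) (c : Bool) : tForm d (lineF d c) (tauPcE d) ≤ bigK d ^ 3 :=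
  tForm_lineF_lineF_le hd c true

/-- `T(τ, lineF c) ≤ 𝕂³`. [folklore] -/
theorem tForm_tau_lineF_le (hd : 1 ≤ d) (c : Bool) : tForm d (tauPcE d) (lineF d c) ≤ bigK d ^ 3 :=
  tForm_lineF_lineF_le hd true c

/-- `T(τ, bbT) ≤ 𝕂³`. [folklore] -/
theorem tForm_tau_bbT_le (hd : 1 ≤ d) : tForm d (tauPcE d) (bbT d) ≤ bigK d ^ 3 := tForm_lineF_bbT_le hd true

/-- `T(bbT, τ) ≤ 𝕂³`. [folklore] -/
theorem tForm_bbT_tau_le (hd : 1 ≤ d) : tForm d (bbT d) (tauPcE d) ≤ bigK d ^ 3 := tForm_bbT_lineF_le hd true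

/-- `kRungL (C·ρ) = (kRungL C)·ρ`. [folklore] -/
theorem kRungL_pkScaleR (C : Site d × Site d → Site d × Site d → ℝ≥0∞) (ρ : Site d × Site d → ℝ≥0∞) :
    kRungL (pkScaleR C ρ) = pkScaleR (kRungL C) ρ := by
  funext p q; simp only [kRungL, pkScaleR_apply, mul_assoc]

/-- ENTRY surgery for an erased `B₂⁽¹⁾`: its input rung goes onto the previous `B₁`. [folklore] -/
theorem surg_entry_b2one (v : Site d × Site d → ℝ≥0∞) (L R : List (Site d × Site d → Site d × Site d → ℝ≥0∞))
    (C : Site d × Site d → Site d × Site d → ℝ≥0∞) :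
    pkChainL v (L ++ kB1 d :: kRungL (kRungR C) :: R) = pkChainL v ((L ++ [pkScaleR (kB1 d) (rho d)]) ++ kRungR C :: R) := by
  rw [kRungL_eq_pkScaleL (kRungR C), pkChainL_append_cons_pkScaleL, List.append_assoc, List.singleton_append]

/-- EXIT surgery for an erased `B₂⁽¹⁾` (inside the five-part form): its output rung goes onto the
next `B₁`. [folklore] -/
theorem surg5_exit_b2one (v e : Site d × Site d → ℝ≥0∞) (L U R : List (Site d × Site d → Site d × Site d → ℝ≥0∞))
    (X C : Site d × Site d → Site d × Site d → ℝ≥0∞) :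
    ∑' s, pkChainL v (L ++ X :: (U ++ kRungL (kRungR C) :: kB1 d :: R)) s * e s =
      ∑' s, pkChainL v (L ++ X :: (U ++ kRungL C :: pkScaleL (rho d) (kB1 d) :: R)) s * e s := by
  have h := pkChainL_append_cons_pkScaleL v (L ++ X :: U) (kRungL C) (rho d) (kB1 d) R
  simp only [List.append_assoc, List.cons_append] at h
  rw [kRungR_eq_pkScaleR C, kRungL_pkScaleR, ← h]

/-- ENTRY surgery for the star: `B₁, S, B₁` merge into `starK`. [folklore] -/
theorem surg_entry_star (v : Site d × Site d → ℝ≥0∞) (L R : List (Site d × Site d → Site d × Site d → ℝ≥0∞)) :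
    pkChainL v (L ++ kB1 d :: kB2twoEr d :: kB1 d :: R) = pkChainL v (L ++ starK d :: R) := by
  have h := pkChainL_append_cons_cons v (L ++ [kB1 d]) (kB2twoEr d) (kB1 d) R
  simp only [List.append_assoc, List.singleton_append] at h
  rw [h, pkChainL_append_cons_cons, starK]

/-- EXIT surgery for the star (inside the five-part form). [folklore] -/
theorem surg5_exit_star (v e : Site d × Site d → ℝ≥0∞) (L U R : List (Site d × Site d → Site d × Site d → ℝ≥0∞))
    (X : Site d × Site d → Site d × Site d → ℝ≥0∞) :
    ∑' s, pkChainL v (L ++ X :: (U ++ kB1 d :: kB2twoEr d :: kB1 d :: R)) s * e s =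
      ∑' s, pkChainL v (L ++ X :: (U ++ starK d :: R)) s * e s := by
  have h := surg_entry_star v (L ++ X :: U) R
  simp only [List.append_assoc, List.cons_append] at h
  rw [h]

/-- A scalar on the second marked kernel (five-part form) comes out. [folklore] -/
theorem tsum_pkChainL_const_mul_kernel₂ (v e : Site d × Site d → ℝ≥0∞)
    (L U R : List (Site d × Site d → Site d × Site d → ℝ≥0∞)) (X K : Site d × Site d → Site d × Site d → ℝ≥0∞) (c : ℝ≥0∞) :
    ∑' s, pkChainL v (L ++ X :: (U ++ (fun p q => c * K p q) :: R)) s * e s =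
      c * ∑' s, pkChainL v (L ++ X :: (U ++ K :: R)) s * e s := by
  have h := tsum_pkChainL_const_mul_kernel v (L ++ X :: U) R c K e
  simp only [List.append_assoc, List.cons_append] at h
  exact h

/-- `altL false (2k+2) = altL false (2k+1) ++ [B₁]`. [folklore] -/
theorem altL_false_odd_add_one (k : ℕ) : altL d false (2 * k + 2) = altL d false (2 * k + 1) ++ [kB1 d] := by
  rw [show 2 * k + 2 = 2 * k + 1 + 1 by ring, altL_add false (2 * k + 1) 1, bodd_two_mul_add_one]; rfl

/-- The point mass at `q₀`. [folklore] -/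
def ptMass (q₀ q : Site d × Site d) : ℝ≥0∞ := if q = q₀ then 1 else 0

/-- The end as a kernel into `(x,x)` closed by the point mass, in five-part form. [folklore] -/
theorem tsum_end_eq (v : Site d × Site d → ℝ≥0∞) (L U : List (Site d × Site d → Site d × Site d → ℝ≥0∞))
    (X Y : Site d × Site d → Site d × Site d → ℝ≥0∞) (q₀ : Site d × Site d) :
    ∑' s, pkChainL v (L ++ X :: U) s * Y s q₀ = ∑' s, pkChainL v (L ++ X :: (U ++ Y :: [])) s * ptMass q₀ s := by
  rw [tsum_pkChainL_mul_col_eq]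
  simp only [List.append_assoc, List.cons_append, ptMass]

/-! ### The leaves with both erased lines inside the fine stages -/

section Leaves

variable (x : Site d)

/-- **`B₁(2i)` and `B₁(2(i+k+1))` erased** (a lone star block between them for `k = 0`,
Cauchy–Schwarz otherwise): `≤ 𝕂¹⁸ κ^{i + (k-1) + t}`. [cite: Hara2008, §3.5] -/
theorem leaf_b1_b1 (hd : 1 ≤ d) (hκ : kap d ≤ 1) (i k t : ℕ) (c c' : Bool) (hrel : c' = (!xor c (Nat.bodd (k + 1)))) :
    ∑' s, pkChainL (kPsiZero d) (altL d true (2 * i) ++ b1Er d c :: (altL d false (2 * k + 1) ++ b1Er d c' :: altL d false (2 * t)))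
      s * kA3end d s x ≤ bigK d ^ 18 * kap d ^ (i + (k - 1) + t) := by
  rcases Nat.eq_zero_or_pos k with rfl | hk
  · have hc' : c' = c := by rw [hrel]; cases c <;> rfl
    rw [hc', show i + (0 - 1) + t = i + t by omega]
    exact cfg_lone hd (kPsiZero d) (fun s => kA3end d s x) (altL d true (2 * i)) (altL d false (2 * t))
      (b1Er d c) (b1Er d c) (!c) i t (le_entry_b1Er c) (le_exit_b1Er c) (lineF_neg (!c))
      (one_le_bigK_sq hd) (one_le_bigK_sq hd) (entryConst_lineF_le hd (!c)) (entryConst_lineF_le hd (!c))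
      (tForm_lineF_lineF_le hd (!c) (!c)) (mass_entry_B1 hd i) (mass_exit_B1 hd t x)
  · exact cfg_one_one hd hκ (kPsiZero d) (fun s => kA3end d s x) (altL d true (2 * i)) (altL d false (2 * t))
      (b1Er d c) (b1Er d c') (!c) (!c') i hk t (le_entry_b1Er c) (le_exit_b1Er c') (mass_entry_B1 hd i)
      (entryConst_lineF_le hd (!c)) (entryConst_lineF_le hd (!c')) (mass_exit_B1 hd t x)

/-- **`B₁(2i)` and `B₂⁽¹⁾(2(i+k)+1)` erased** (adjacent for `k = 0`): `≤ 𝕂¹⁸ κ^{i + (k-2) + t}`. [cite: Hara2008, §3.5] -/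
theorem leaf_b1_b2one (hd : 1 ≤ d) (hκ : kap d ≤ 1) (i k t : ℕ) (c c' : Bool) (hrel : c' = (!xor c (Nat.bodd k))) :
    ∑' s, pkChainL (kPsiZero d) (altL d true (2 * i) ++ b1Er d c ::
      (altL d false (2 * k) ++ kRungL (kRungR (b2oneCore d c')) :: altL d true (2 * t + 1))) s * kA3end d s x ≤
      bigK d ^ 18 * kap d ^ (i + (k - 2) + t) := by
  rw [altL_true_succ (2 * t), surg5_exit_b2one]
  rcases Nat.eq_zero_or_pos k with rfl | hk
  · have hc' : c' = !c := by rw [hrel]; cases c <;> rfl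
    rw [hc', show i + (0 - 2) + t = i + t by omega]
    exact cfg_rungOnly hd (kPsiZero d) (fun s => kA3end d s x) (altL d true (2 * i))
      (pkScaleL (rho d) (kB1 d) :: altL d false (2 * t)) (b1Er d c) (kRungL (b2oneCore d (!c))) (!c) (!!c)
      (by cases c <;> decide) i t (le_entry_b1Er c) (le_exit_b2one (!c)) one_mul_rho_le (lineF_neg (!c)) tauPcE_neg
      (one_le_bigK_sq hd) (one_le_bigK_sq hd) (tForm_lineF_tau_le hd (!c)) (mass_entry_B1 hd i) (mass_exit_B2 hd t x)
  · obtain ⟨m, rfl⟩ := Nat.exists_eq_add_of_le' hk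
    rw [show 2 * (m + 1) = 2 * m + 2 by ring, show i + (m + 1 - 2) + t = i + (m - 1) + t by omega]
    exact cfg_one_rho hd hκ (kPsiZero d) (fun s => kA3end d s x) (altL d true (2 * i))
      (pkScaleL (rho d) (kB1 d) :: altL d false (2 * t)) (b1Er d c) (kRungL (b2oneCore d c')) (!c) (!c') i m t
      (le_entry_b1Er c) (le_exit_b2one c') (mass_entry_B1 hd i) (entryConst_lineF_le hd (!c)) (entryConst_tau_le hd)
      (mass_exit_B2 hd t x)

/-- **`B₁(2i)` and the star of `B₂(2(i+k)+1)` erased** (Overlap A for `k = 0`, the lone star block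
for `k = 1`): `≤ 𝕂¹⁸ κ^{i + (k-2) + t}`. [cite: Hara2008, §3.5] -/
theorem leaf_b1_star (hd : 1 ≤ d) (hκ : kap d ≤ 1) (i k t : ℕ) (c : Bool) (hrel : true = (!xor c (Nat.bodd k))) :
    ∑' s, pkChainL (kPsiZero d) (altL d true (2 * i) ++ b1Er d c ::
      (altL d false (2 * k) ++ kB2twoEr d :: altL d true (2 * t + 1))) s * kA3end d s x ≤
      bigK d ^ 18 * kap d ^ (i + (k - 2) + t) := by
  rcases k with _ | _ | m
  · -- Overlap A: the erased `B₁`-line is on coordinate 2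
    cases c
    · rw [show i + (0 - 2) + t = i + t by omega]
      exact cfg_conflictA hd i t x
    · exact absurd hrel (by decide)
  · -- the lone star block `B₂(2i+1)` between `B₁(2i)` (line 1 erased) and the merged star
    cases c
    · exact absurd hrel (by decide)
    · rw [show i + (0 + 1 - 2) + t = i + t by omega]
      show ∑' s, pkChainL (kPsiZero d) (altL d true (2 * i) ++ b1Er d true ::
        ([kB2 d] ++ kB1 d :: kB2twoEr d :: kB1 d :: altL d false (2 * t))) s * kA3end d s x ≤ _
      rw [surg5_exit_star]
      exact cfg_lone hd (kPsiZero d) (fun s => kA3end d s x) (altL d true (2 * i)) (altL d false (2 * t))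
        (b1Er d true) (starK d) false i t (le_entry_b1Er true) (le_exit_starK) bbT_neg (one_le_bigK_sq hd)
        (triTilde_tri_le_bigK_sq hd) (entryConst_lineF_le hd false) (entryConst_star_le hd) (tForm_lineF_bbT_le hd false)
        (mass_entry_B1 hd i) (mass_exit_B1 hd t x)
  · -- at least one full unit between: Cauchy–Schwarz
    rw [show 2 * (m + 1 + 1) = 2 * (m + 1) + 2 by ring, altL_false_odd_add_one, altL_true_succ (2 * t), List.append_assoc,
      List.singleton_append, surg5_exit_star, show i + (m + 1 + 1 - 2) + t = i + (m + 1 - 1) + t by omega]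
    exact cfg_one_one hd hκ (kPsiZero d) (fun s => kA3end d s x) (altL d true (2 * i)) (altL d false (2 * t))
      (b1Er d c) (starK d) (!c) false i (Nat.succ_pos m) t (le_entry_b1Er c) le_exit_starK (mass_entry_B1 hd i)
      (entryConst_lineF_le hd (!c)) (entryConst_star_le hd) (mass_exit_B1 hd t x)

/-- **`B₂⁽¹⁾(2i+1)` and `B₁(2(i+k+1))` erased** (adjacent for `k = 0`): `≤ 𝕂¹⁸ κ^{i + (k-2) + t}`. [cite: Hara2008, §3.5] -/
theorem leaf_b2one_b1 (hd : 1 ≤ d) (hκ : kap d ≤ 1) (i k t : ℕ) (c c' : Bool) (hrel : c' = (!xor c (Nat.bodd (k + 1)))) :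
    ∑' s, pkChainL (kPsiZero d) (altL d true (2 * i + 1) ++ kRungL (kRungR (b2oneCore d c)) ::
      (altL d true (2 * k) ++ b1Er d c' :: altL d false (2 * t))) s * kA3end d s x ≤
      bigK d ^ 18 * kap d ^ (i + (k - 2) + t) := by
  rw [altL_true_two_mul_add_one i, List.append_assoc, List.singleton_append, surg_entry_b2one]
  rcases Nat.eq_zero_or_pos k with rfl | hk
  · have hc' : c' = c := by rw [hrel]; cases c <;> rfl
    rw [hc', show i + (0 - 2) + t = i + t by omega]
    exact cfg_rungOnly hd (kPsiZero d) (fun s => kA3end d s x) (altL d true (2 * i) ++ [pkScaleR (kB1 d) (rho d)])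
      (altL d false (2 * t)) (kRungR (b2oneCore d c)) (b1Er d c) c (!c) (by cases c <;> decide) i t
      (le_entry_b2one c) (le_exit_b1Er c) rho_mul_one_le tauPcE_neg (lineF_neg (!c))
      (one_le_bigK_sq hd) (one_le_bigK_sq hd) (tForm_tau_lineF_le hd (!c)) (mass_entry_B2 hd i) (mass_exit_B1 hd t x)
  · obtain ⟨m, rfl⟩ := Nat.exists_eq_add_of_le' hk
    rw [show 2 * (m + 1) = 2 * m + 2 by ring, show i + (m + 1 - 2) + t = i + (m - 1) + t by omega]
    exact cfg_rho_one hd hκ (kPsiZero d) (fun s => kA3end d s x) (altL d true (2 * i) ++ [pkScaleR (kB1 d) (rho d)])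
      (altL d false (2 * t)) (kRungR (b2oneCore d c)) (b1Er d c') c (!c') i m t
      (le_entry_b2one c) (le_exit_b1Er c') (mass_entry_B2 hd i) (entryConst_tau_le hd) (entryConst_lineF_le hd (!c'))
      (mass_exit_B1 hd t x)

/-- **The star of `B₂(2i+1)` and `B₁(2(i+k+1))` erased** (Overlap B for `k = 0`, the lone star block
for `k = 1`): `≤ 𝕂¹⁸ κ^{i + (k-2) + t}`. [cite: Hara2008, §3.5] -/
theorem leaf_star_b1 (hd : 1 ≤ d) (hκ : kap d ≤ 1) (i k t : ℕ) (c' : Bool) (hrel : c' = (!xor true (Nat.bodd (k + 1)))) :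
    ∑' s, pkChainL (kPsiZero d) (altL d true (2 * i + 1) ++ kB2twoEr d ::
      (altL d true (2 * k) ++ b1Er d c' :: altL d false (2 * t))) s * kA3end d s x ≤
      bigK d ^ 18 * kap d ^ (i + (k - 2) + t) := by
  rw [altL_true_two_mul_add_one i, List.append_assoc, List.singleton_append]
  rcases k with _ | _ | m
  · -- Overlap B: the erased `B₁`-line after the star is on coordinate 1
    have hc' : c' = true := by rw [hrel]; rfl
    rw [hc', show i + (0 - 2) + t = i + t by omega]
    exact cfg_conflictB hd i t x
  · -- the lone star block `B₂(2i+3)` between the merged star and `B₁(2i+4)` (line 2 erased)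
    have hc' : c' = false := by rw [hrel]; rfl
    rw [hc', show i + (0 + 1 - 2) + t = i + t by omega]
    show ∑' s, pkChainL (kPsiZero d) (altL d true (2 * i) ++ kB1 d :: kB2twoEr d :: kB1 d ::
      kB2 d :: b1Er d false :: altL d false (2 * t)) s * kA3end d s x ≤ _
    rw [surg_entry_star]
    exact cfg_lone hd (kPsiZero d) (fun s => kA3end d s x) (altL d true (2 * i)) (altL d false (2 * t))
      (starK d) (b1Er d false) true i t le_entry_starK (le_exit_b1Er false) (lineF_neg (!false))
      (triTilde_tri_le_bigK_sq hd) (one_le_bigK_sq hd) (entryConst_star_le hd) (entryConst_lineF_le hd (!false))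
      (tForm_bbT_lineF_le hd (!false)) (mass_entry_B1 hd i) (mass_exit_B1 hd t x)
  · rw [show 2 * (m + 1 + 1) = 2 * (m + 1) + 1 + 1 by ring, altL_true_succ (2 * (m + 1) + 1), List.cons_append,
      surg_entry_star, show i + (m + 1 + 1 - 2) + t = i + (m + 1 - 1) + t by omega]
    exact cfg_one_one hd hκ (kPsiZero d) (fun s => kA3end d s x) (altL d true (2 * i)) (altL d false (2 * t))
      (starK d) (b1Er d c') true (!c') i (Nat.succ_pos m) t le_entry_starK (le_exit_b1Er c') (mass_entry_B1 hd i)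
      (entryConst_star_le hd) (entryConst_lineF_le hd (!c')) (mass_exit_B1 hd t x)

/-- **`B₂⁽¹⁾(2i+1)` and `B₂⁽¹⁾(2(i+k+1)+1)` erased** (the middle factor `ρB₁(B₂B₁)^kρ'` always closes):
`≤ 𝕂¹⁸ κ^{i + (k-1) + t}`. [cite: Hara2008, §3.5] -/
theorem leaf_b2one_b2one (hd : 1 ≤ d) (i k t : ℕ) (c c' : Bool) :
    ∑' s, pkChainL (kPsiZero d) (altL d true (2 * i + 1) ++ kRungL (kRungR (b2oneCore d c)) ::
      (altL d true (2 * k + 1) ++ kRungL (kRungR (b2oneCore d c')) :: altL d true (2 * t + 1))) s * kA3end d s x ≤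
      bigK d ^ 18 * kap d ^ (i + (k - 1) + t) := by
  rw [altL_true_two_mul_add_one i, List.append_assoc, List.singleton_append, surg_entry_b2one, altL_true_succ (2 * t),
    surg5_exit_b2one]
  exact cfg_rho_rho hd (kPsiZero d) (fun s => kA3end d s x) (altL d true (2 * i) ++ [pkScaleR (kB1 d) (rho d)])
    (pkScaleL (rho d) (kB1 d) :: altL d false (2 * t)) (kRungR (b2oneCore d c)) (kRungL (b2oneCore d c')) c (!c') i k t
    (le_entry_b2one c) (le_exit_b2one c') (mass_entry_B2 hd i) (entryConst_tau_le hd) (entryConst_tau_le hd)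
    (mass_exit_B2 hd t x)

/-- **`B₂⁽¹⁾(2i+1)` and the star of `B₂(2(i+k+1)+1)` erased** (adjacent for `k = 0`):
`≤ 𝕂¹⁸ κ^{i + (k-2) + t}`. [cite: Hara2008, §3.5] -/
theorem leaf_b2one_star (hd : 1 ≤ d) (hκ : kap d ≤ 1) (i k t : ℕ) (c : Bool) (hrel : true = (!xor c (Nat.bodd (k + 1)))) :
    ∑' s, pkChainL (kPsiZero d) (altL d true (2 * i + 1) ++ kRungL (kRungR (b2oneCore d c)) ::
      (altL d true (2 * k + 1) ++ kB2twoEr d :: altL d true (2 * t + 1))) s * kA3end d s x ≤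
      bigK d ^ 18 * kap d ^ (i + (k - 2) + t) := by
  rw [altL_true_two_mul_add_one i, List.append_assoc, List.singleton_append, surg_entry_b2one,
    altL_true_two_mul_add_one k, altL_true_succ (2 * t),
    List.append_assoc (altL d true (2 * k)) [kB1 d] (kB2twoEr d :: kB1 d :: altL d false (2 * t)), List.singleton_append,
    surg5_exit_star]
  rcases Nat.eq_zero_or_pos k with rfl | hk
  · have hc : c = true := by cases c; exact absurd hrel (by decide); rfl
    rw [hc, show i + (0 - 2) + t = i + t by omega]
    exact cfg_rungOnly hd (kPsiZero d) (fun s => kA3end d s x) (altL d true (2 * i) ++ [pkScaleR (kB1 d) (rho d)])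
      (altL d false (2 * t)) (kRungR (b2oneCore d true)) (starK d) true false (by decide) i t
      (le_entry_b2one true) le_exit_starK rho_mul_one_le tauPcE_neg bbT_neg
      (one_le_bigK_sq hd) (triTilde_tri_le_bigK_sq hd) (tForm_tau_bbT_le hd) (mass_entry_B2 hd i) (mass_exit_B1 hd t x)
  · obtain ⟨m, rfl⟩ := Nat.exists_eq_add_of_le' hk
    rw [show 2 * (m + 1) = 2 * m + 2 by ring, show i + (m + 1 - 2) + t = i + (m - 1) + t by omega]
    exact cfg_rho_one hd hκ (kPsiZero d) (fun s => kA3end d s x) (altL d true (2 * i) ++ [pkScaleR (kB1 d) (rho d)])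
      (altL d false (2 * t)) (kRungR (b2oneCore d c)) (starK d) c false i m t
      (le_entry_b2one c) le_exit_starK (mass_entry_B2 hd i) (entryConst_tau_le hd) (entryConst_star_le hd)
      (mass_exit_B1 hd t x)

/-- **The star of `B₂(2i+1)` and `B₂⁽¹⁾(2(i+k+1)+1)` erased** (adjacent for `k = 0`):
`≤ 𝕂¹⁸ κ^{i + (k-2) + t}`. [cite: Hara2008, §3.5] -/
theorem leaf_star_b2one (hd : 1 ≤ d) (hκ : kap d ≤ 1) (i k t : ℕ) (c' : Bool) (hrel : c' = (!xor true (Nat.bodd (k + 1)))) :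
    ∑' s, pkChainL (kPsiZero d) (altL d true (2 * i + 1) ++ kB2twoEr d ::
      (altL d true (2 * k + 1) ++ kRungL (kRungR (b2oneCore d c')) :: altL d true (2 * t + 1))) s * kA3end d s x ≤
      bigK d ^ 18 * kap d ^ (i + (k - 2) + t) := by
  rw [altL_true_two_mul_add_one i, List.append_assoc, List.singleton_append, altL_true_succ (2 * k), List.cons_append,
    surg_entry_star, altL_true_succ (2 * t), surg5_exit_b2one]
  rcases Nat.eq_zero_or_pos k with rfl | hk
  · have hc' : c' = true := by rw [hrel]; rfl
    rw [hc', show i + (0 - 2) + t = i + t by omega]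
    exact cfg_rungOnly hd (kPsiZero d) (fun s => kA3end d s x) (altL d true (2 * i))
      (pkScaleL (rho d) (kB1 d) :: altL d false (2 * t)) (starK d) (kRungL (b2oneCore d true)) true (!true) (by decide) i t
      le_entry_starK (le_exit_b2one true) one_mul_rho_le bbT_neg tauPcE_neg
      (triTilde_tri_le_bigK_sq hd) (one_le_bigK_sq hd) (tForm_bbT_tau_le hd) (mass_entry_B1 hd i) (mass_exit_B2 hd t x)
  · obtain ⟨m, rfl⟩ := Nat.exists_eq_add_of_le' hk
    rw [show 2 * (m + 1) = 2 * m + 2 by ring, show i + (m + 1 - 2) + t = i + (m - 1) + t by omega]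
    exact cfg_one_rho hd hκ (kPsiZero d) (fun s => kA3end d s x) (altL d true (2 * i))
      (pkScaleL (rho d) (kB1 d) :: altL d false (2 * t)) (starK d) (kRungL (b2oneCore d c')) true (!c') i m t
      le_entry_starK (le_exit_b2one c') (mass_entry_B1 hd i) (entryConst_star_le hd) (entryConst_tau_le hd)
      (mass_exit_B2 hd t x)

/-- **Two stars erased, units `i+1` and `i+k+2`** (Overlap C for `k = 0`; `k = 1` cannot occur for two
different strands; Cauchy–Schwarz for `k ≥ 2`): `≤ 𝕂¹⁸ κ^{i + (k-2) + t}`. [cite: Hara2008, §3.5] -/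
theorem leaf_star_star (hd : 1 ≤ d) (hκ : kap d ≤ 1) (i k t : ℕ) (hrel : true = (!xor true (Nat.bodd (k + 1)))) :
    ∑' s, pkChainL (kPsiZero d) (altL d true (2 * i + 1) ++ kB2twoEr d ::
      (altL d true (2 * k + 1) ++ kB2twoEr d :: altL d true (2 * t + 1))) s * kA3end d s x ≤
      bigK d ^ 18 * kap d ^ (i + (k - 2) + t) := by
  rw [altL_true_two_mul_add_one i, List.append_assoc, List.singleton_append]
  rcases k with _ | _ | m
  · rw [show i + (0 - 2) + t = i + t by omega]
    exact cfg_conflictC hd i t x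
  · exact absurd hrel (by decide)
  · rw [show 2 * (m + 1 + 1) + 1 = 2 * (m + 1) + 2 + 1 by ring, altL_true_succ (2 * (m + 1) + 2), List.cons_append,
      surg_entry_star, altL_false_odd_add_one, altL_true_succ (2 * t), List.append_assoc, List.singleton_append,
      surg5_exit_star, show i + (m + 1 + 1 - 2) + t = i + (m + 1 - 1) + t by omega]
    exact cfg_one_one hd hκ (kPsiZero d) (fun s => kA3end d s x) (altL d true (2 * i)) (altL d false (2 * t))
      (starK d) (starK d) true false i (Nat.succ_pos m) t le_entry_starK le_exit_starK (mass_entry_B1 hd i)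
      (entryConst_star_le hd) (entryConst_star_le hd) (mass_exit_B1 hd t x)

/-! ### The leaves with an erased start line -/

/-- **Start line to `c` and `B₁(2i')` erased** (adjacent for `i' = 0`): `≤ 𝕂¹⁸ κ^{i' - 2 + t}`. [cite: Hara2008, §3.5] -/
theorem leaf_V_b1 (hd : 1 ≤ d) (hκ : kap d ≤ 1) (i' t : ℕ) (c c' : Bool) (hrel : c' = xor c (cAt (2 * i'))) :
    ∑' s, pkChainL (vDelta d) ([] ++ stEr d c :: (altL d true (2 * i') ++ b1Er d c' :: altL d false (2 * t))) s * kA3end d s x ≤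
      bigK d ^ 18 * kap d ^ (i' - 2 + t) := by
  rcases Nat.eq_zero_or_pos i' with rfl | hi
  · have hc' : c' = !c := by rw [hrel]; cases c <;> rfl
    rw [hc', show 0 - 2 + t = 0 + t by omega]
    exact cfg_rungOnly hd (vDelta d) (fun s => kA3end d s x) [] (altL d false (2 * t)) (stEr d c) (b1Er d (!c)) (!c) (!!c)
      (by cases c <;> decide) 0 t (le_entry_stEr c) (le_exit_b1Er (!c)) rho_mul_one_le tauPcE_neg (lineF_neg (!!c))
      (one_le_bigK_sq hd) (one_le_bigK_sq hd) (tForm_tau_lineF_le hd (!!c)) (mass_entry_V hd) (mass_exit_B1 hd t x)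
  · obtain ⟨m, rfl⟩ := Nat.exists_eq_add_of_le' hi
    rw [show 2 * (m + 1) = 2 * m + 2 by ring, show m + 1 - 2 + t = 0 + (m - 1) + t by omega]
    exact cfg_rho_one hd hκ (vDelta d) (fun s => kA3end d s x) [] (altL d false (2 * t)) (stEr d c) (b1Er d c') (!c) (!c')
      0 m t (le_entry_stEr c) (le_exit_b1Er c') (mass_entry_V hd) (entryConst_tau_le hd) (entryConst_lineF_le hd (!c'))
      (mass_exit_B1 hd t x)

/-- **Start line and `B₂⁽¹⁾(2i'+1)` erased**: `≤ 𝕂¹⁸ κ^{i' - 1 + t}`. [cite: Hara2008, §3.5] -/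
theorem leaf_V_b2one (hd : 1 ≤ d) (i' t : ℕ) (c c' : Bool) :
    ∑' s, pkChainL (vDelta d) ([] ++ stEr d c :: (altL d true (2 * i' + 1) ++ kRungL (kRungR (b2oneCore d c')) ::
      altL d true (2 * t + 1))) s * kA3end d s x ≤ bigK d ^ 18 * kap d ^ (i' - 1 + t) := by
  rw [altL_true_succ (2 * t), surg5_exit_b2one, show i' - 1 + t = 0 + (i' - 1) + t by omega]
  exact cfg_rho_rho hd (vDelta d) (fun s => kA3end d s x) [] (pkScaleL (rho d) (kB1 d) :: altL d false (2 * t))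
    (stEr d c) (kRungL (b2oneCore d c')) (!c) (!c') 0 i' t (le_entry_stEr c) (le_exit_b2one c') (mass_entry_V hd)
    (entryConst_tau_le hd) (entryConst_tau_le hd) (mass_exit_B2 hd t x)

/-- **Start line to `c` and the star of `B₂(2i'+1)` erased** (adjacent for `i' = 0`): `≤ 𝕂¹⁸ κ^{i' - 2 + t}`. [cite: Hara2008, §3.5] -/
theorem leaf_V_star (hd : 1 ≤ d) (hκ : kap d ≤ 1) (i' t : ℕ) (c : Bool) (hrel : true = xor c (cAt (2 * i' + 1))) :
    ∑' s, pkChainL (vDelta d) ([] ++ stEr d c :: (altL d true (2 * i' + 1) ++ kB2twoEr d :: altL d true (2 * t + 1))) s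
      * kA3end d s x ≤ bigK d ^ 18 * kap d ^ (i' - 2 + t) := by
  rw [altL_true_two_mul_add_one i', altL_true_succ (2 * t), List.append_assoc, List.singleton_append, surg5_exit_star]
  rcases Nat.eq_zero_or_pos i' with rfl | hi
  · have hc : c = false := by
      rw [cAt_two_mul_add_one] at hrel
      cases c; rfl; exact absurd hrel (by decide)
    rw [hc, show 0 - 2 + t = 0 + t by omega]
    exact cfg_rungOnly hd (vDelta d) (fun s => kA3end d s x) [] (altL d false (2 * t)) (stEr d false) (starK d) (!false) false
      (by decide) 0 t (le_entry_stEr false) le_exit_starK rho_mul_one_le tauPcE_neg bbT_neg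
      (one_le_bigK_sq hd) (triTilde_tri_le_bigK_sq hd) (tForm_tau_bbT_le hd) (mass_entry_V hd) (mass_exit_B1 hd t x)
  · obtain ⟨m, rfl⟩ := Nat.exists_eq_add_of_le' hi
    rw [show 2 * (m + 1) = 2 * m + 2 by ring, show m + 1 - 2 + t = 0 + (m - 1) + t by omega]
    exact cfg_rho_one hd hκ (vDelta d) (fun s => kA3end d s x) [] (altL d false (2 * t)) (stEr d c) (starK d) (!c) false
      0 m t (le_entry_stEr c) le_exit_starK (mass_entry_V hd) (entryConst_tau_le hd) (entryConst_star_le hd)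
      (mass_exit_B1 hd t x)

/-! ### The leaves with an erased end line -/

/-- **`B₁(2i)` and the end line erased** (adjacent for `t = 0`): `≤ 𝕂¹⁸ κ^{i + (t-2)}`. [cite: Hara2008, §3.5] -/
theorem leaf_b1_E (hd : 1 ≤ d) (hκ : kap d ≤ 1) (i t : ℕ) (c cx : Bool) (hrel : cx = (!xor c (Nat.bodd t))) :
    ∑' s, pkChainL (kPsiZero d) (altL d true (2 * i) ++ b1Er d c :: (altL d false (2 * t) ++ enEr d cx :: [])) s
      * ptMass (x, x) s ≤ bigK d ^ 18 * kap d ^ (i + (t - 2)) := by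
  rcases Nat.eq_zero_or_pos t with rfl | ht
  · have hcx : cx = !c := by rw [hrel]; cases c <;> rfl
    rw [hcx, show i + (0 - 2) = i + 0 by omega]
    exact cfg_rungOnly hd (kPsiZero d) (ptMass (x, x)) (altL d true (2 * i)) [] (b1Er d c) (enEr d (!c)) (!c) (!!c)
      (by cases c <;> decide) i 0 (le_entry_b1Er c) (le_exit_enEr (!c)) one_mul_rho_le (lineF_neg (!c)) tauPcE_neg
      (one_le_bigK_sq hd) (one_le_bigK_sq hd) (tForm_lineF_tau_le hd (!c)) (mass_entry_B1 hd i) (mass_exit_E hd (x, x))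
  · obtain ⟨m, rfl⟩ := Nat.exists_eq_add_of_le' ht
    rw [show 2 * (m + 1) = 2 * m + 2 by ring, show i + (m + 1 - 2) = i + (m - 1) + 0 by omega]
    exact cfg_one_rho hd hκ (kPsiZero d) (ptMass (x, x)) (altL d true (2 * i)) [] (b1Er d c) (enEr d cx) (!c) (!cx) i m 0
      (le_entry_b1Er c) (le_exit_enEr cx) (mass_entry_B1 hd i) (entryConst_lineF_le hd (!c)) (entryConst_tau_le hd)
      (mass_exit_E hd (x, x))

/-- **`B₂⁽¹⁾(2i+1)` and the end line erased**: `≤ 𝕂¹⁸ κ^{i + (t-1)}`. [cite: Hara2008, §3.5] -/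
theorem leaf_b2one_E (hd : 1 ≤ d) (i t : ℕ) (c cx : Bool) :
    ∑' s, pkChainL (kPsiZero d) (altL d true (2 * i + 1) ++ kRungL (kRungR (b2oneCore d c)) ::
      (altL d true (2 * t + 1) ++ enEr d cx :: [])) s * ptMass (x, x) s ≤ bigK d ^ 18 * kap d ^ (i + (t - 1)) := by
  rw [altL_true_two_mul_add_one i, List.append_assoc, List.singleton_append, surg_entry_b2one,
    show i + (t - 1) = i + (t - 1) + 0 by omega]
  exact cfg_rho_rho hd (kPsiZero d) (ptMass (x, x)) (altL d true (2 * i) ++ [pkScaleR (kB1 d) (rho d)]) []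
    (kRungR (b2oneCore d c)) (enEr d cx) c (!cx) i t 0 (le_entry_b2one c) (le_exit_enEr cx) (mass_entry_B2 hd i)
    (entryConst_tau_le hd) (entryConst_tau_le hd) (mass_exit_E hd (x, x))

/-- **The star of `B₂(2i+1)` and the end line erased** (adjacent for `t = 0`): `≤ 𝕂¹⁸ κ^{i + (t-2)}`. [cite: Hara2008, §3.5] -/
theorem leaf_star_E (hd : 1 ≤ d) (hκ : kap d ≤ 1) (i t : ℕ) (cx : Bool) (hrel : cx = (!xor true (Nat.bodd (t + 1)))) :
    ∑' s, pkChainL (kPsiZero d) (altL d true (2 * i + 1) ++ kB2twoEr d :: (altL d true (2 * t + 1) ++ enEr d cx :: [])) s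
      * ptMass (x, x) s ≤ bigK d ^ 18 * kap d ^ (i + (t - 2)) := by
  rw [altL_true_two_mul_add_one i, List.append_assoc, List.singleton_append, altL_true_succ (2 * t), List.cons_append,
    surg_entry_star]
  rcases Nat.eq_zero_or_pos t with rfl | ht
  · have hcx : cx = true := by rw [hrel]; rfl
    rw [hcx, show i + (0 - 2) = i + 0 by omega]
    exact cfg_rungOnly hd (kPsiZero d) (ptMass (x, x)) (altL d true (2 * i)) [] (starK d) (enEr d true) true (!true)
      (by decide) i 0 le_entry_starK (le_exit_enEr true) one_mul_rho_le bbT_neg tauPcE_neg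
      (triTilde_tri_le_bigK_sq hd) (one_le_bigK_sq hd) (tForm_bbT_tau_le hd) (mass_entry_B1 hd i) (mass_exit_E hd (x, x))
  · obtain ⟨m, rfl⟩ := Nat.exists_eq_add_of_le' ht
    rw [show 2 * (m + 1) = 2 * m + 2 by ring, show i + (m + 1 - 2) = i + (m - 1) + 0 by omega]
    exact cfg_one_rho hd hκ (kPsiZero d) (ptMass (x, x)) (altL d true (2 * i)) [] (starK d) (enEr d cx) true (!cx) i m 0
      le_entry_starK (le_exit_enEr cx) (mass_entry_B1 hd i) (entryConst_star_le hd) (entryConst_tau_le hd)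
      (mass_exit_E hd (x, x))

/-- **Start line and end line erased** (the two lines connecting `0` and `x` at the lowest order of
each path): `≤ 𝕂¹⁸ κ^{n-1}`. [cite: Hara2008, §3.5] -/
theorem leaf_V_E (hd : 1 ≤ d) (n : ℕ) (c cx : Bool) :
    ∑' s, pkChainL (vDelta d) ([] ++ stEr d c :: (altL d true (2 * n + 1) ++ enEr d cx :: [])) s * ptMass (x, x) s ≤
      bigK d ^ 18 * kap d ^ (n - 1) := by
  rw [show n - 1 = 0 + (n - 1) + 0 by omega]
  exact cfg_rho_rho hd (vDelta d) (ptMass (x, x)) [] [] (stEr d c) (enEr d cx) (!c) (!cx) 0 n 0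
    (le_entry_stEr c) (le_exit_enEr cx) (mass_entry_V hd) (entryConst_tau_le hd) (entryConst_tau_le hd) (mass_exit_E hd (x, x))

end Leaves

end Literature.Barriers.CriticalPhenomena
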